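import Literature.NumberTheory.Sieve.FGKMT2018QuadFormSwap
import HarnessLib

/-!
# FGKMT 2018 Theorem 6 / Maynard 2016 Prop. 9.1: `T(r,s) = 0` unless `r = s`

Sources: J. Maynard, *Dense clusters of primes in subsets*, Compositio Math. 152 (2016) =
arXiv:1405.2593 [Maynard2016DenseClusters], proof of Proposition 9.1 p. 19, display (9.5) and the
sentence after it («Since `∏_{p∣rs} S_p(r,s) = 0` if there is a prime `p` which divides one of `r, s`
but not the other, we can restrict to `r = s`»); K. Ford, B. Green, S. Konyagin, J. Maynard,
T. Tao, *Long gaps between primes*, JAMS 31 (2018) = arXiv:1412.5029v4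
[FordGreenKonyaginMaynardTao2018], (7.7) p. 21.

PROVED here (no named facts) for `localPairSum` of `FGKMT2018QuadFormSwap`
(`T(r,s) = ∑'_{d∣r, e∣s} μ(d)μ(e)de/∏[dᵢ,eᵢ]`, cross-coprime pairs):

* helpers `coprime_prime_mul_iff`, `cross_update_iff`;
* **`sum_filter_dvd_pairTerm_eq_zero`** — for `r, s ∈ 𝒟_k(𝓛)`, `e ∣ s` and a prime `p ∣ r_j`,
  `p ∤ ∏sᵢ`: the `d`-sum of the summand of `T(r,s)` vanishes, by the sign-reversing involution
  `d ↦ d` with `p` toggled in `d_j` (`μ` flips; `∏dᵢ` and `∏[dᵢ,eᵢ]` both change by the factor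
  `p`; cross-coprimality is invariant) — the `S_p = 0` case of (9.5);
* `localPairSum_comm`, **`localPairSum_eq_zero_of_dvd_of_not_dvd`** (and `…_of_not_dvd_of_dvd`),
  **`localPairSum_eq_zero_of_prod_ne`** — `T(r,s) = 0` unless `∏rᵢ = ∏sᵢ` («we can restrict
  to `r = s`»).

What remains of (9.5) is the value `T(r,s) = μ(A)φ(r)/φ(A)` when `∏rᵢ = ∏sᵢ`
(`A = r/∏(rᵢ,sᵢ)`; `S_p = p − 1` resp. `−1`).

## References
* J. Maynard, *Dense clusters of primes in subsets*, Compositio Math. 152 (2016), (9.5)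
  [Maynard2016DenseClusters].
* K. Ford, B. Green, S. Konyagin, J. Maynard, T. Tao, *Long gaps between primes*, JAMS 31 (2018),
  (7.7) [FordGreenKonyaginMaynardTao2018].
-/

noncomputable section

open Finset
open scoped ArithmeticFunction.Moebius

namespace Literature.NumberTheory.Sieve.FGKMT2018

variable {k : ℕ}

/-! ### Arithmetic helpers -/

/-- `(p m, n) = 1 ↔ (m, n) = 1` for a prime `p ∤ n`. [cite: Maynard2016DenseClusters, proof of Prop. 9.1 p. 19] -/
theorem coprime_prime_mul_iff {p m n : ℕ} (hp : p.Prime) (hpn : ¬ p ∣ n) :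
    (p * m).Coprime n ↔ m.Coprime n := by
  rw [Nat.coprime_mul_iff_left]
  exact ⟨fun h => h.2, fun h => ⟨(Nat.Prime.coprime_iff_not_dvd hp).2 hpn, h⟩⟩

/-- The cross-coprimality predicate is unchanged when `d_j e_j` is replaced by a `p`-multiple /
`p`-quotient related value, `p` coprime to the other `d_l e_l`.
[cite: Maynard2016DenseClusters, proof of Prop. 9.1 p. 19 (∑' restriction)] -/
theorem cross_update_iff (d e : Fin k → ℕ) (j : Fin k) (v : ℕ)
    (hv : ∀ n : ℕ, (∃ l, l ≠ j ∧ n = d l * e l) → ((v * e j).Coprime n ↔ (d j * e j).Coprime n)) :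
    (∀ i l, i ≠ l → (Function.update d j v i * e i).Coprime (Function.update d j v l * e l)) ↔
      ∀ i l, i ≠ l → (d i * e i).Coprime (d l * e l) := by
  refine forall_congr' fun i => forall_congr' fun l => imp_congr_right fun hil => ?_
  by_cases hi : i = j
  · subst hi
    have hl : l ≠ i := fun h => hil h.symm
    rw [Function.update_self, Function.update_of_ne hl]
    exact hv _ ⟨l, hl, rfl⟩
  · by_cases hl : l = j
    · subst hl
      rw [Function.update_self, Function.update_of_ne hi, Nat.coprime_comm,
        hv _ ⟨i, hi, rfl⟩, Nat.coprime_comm]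
    · rw [Function.update_of_ne hi, Function.update_of_ne hl]

/-! ### The sign-reversing involution: `S_p = 0` -/

/-- **The case `S_p = 0` of (9.5)**: for `r, s ∈ 𝒟_k(𝓛)`, `e ∣ s` coordinatewise, and a prime
`p ∣ r_j` with `p ∤ ∏ sᵢ`, the `d`-sum of the summand of `T(r,s)` vanishes (involution
`d_j ↦ d_j p^{±1}`). [cite: Maynard2016DenseClusters, proof of Prop. 9.1 p. 19, (9.5) (case «p ∣ r and p ∤ s»)] -/
theorem sum_filter_dvd_pairTerm_eq_zero {L : Fin k → ℤ × ℤ} {B : ℕ} {R : ℝ} {r s e : Fin k → ℕ}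
    (hr : r ∈ dkBox L B R) (he : ∀ i, e i ∣ s i) {p : ℕ} (hp : p.Prime) {j : Fin k} (hpj : p ∣ r j)
    (hps : ¬ p ∣ ∏ i, s i) :
    ∑ d ∈ (dkBox L B R).filter (fun d => ∀ i, d i ∣ r i),
      (if ∀ i l, i ≠ l → (d i * e i).Coprime (d l * e l) then
        ((μ (∏ i, d i) : ℤ) : ℝ) * ((μ (∏ i, e i) : ℤ) : ℝ) * ((∏ i, (d i : ℝ)) * ∏ i, (e i : ℝ)) /
          ∏ i, ((Nat.lcm (d i) (e i) : ℕ) : ℝ) else 0) = 0 := by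
  classical
  have hpprime : Prime p := Nat.prime_iff.1 hp
  have hpe : ∀ i, ¬ p ∣ e i := fun i h =>
    hps ((h.trans (he i)).trans (Finset.dvd_prod_of_mem _ (Finset.mem_univ i)))
  have hrsq : Squarefree (r j) := squarefree_apply_of_mem_dkBox hr j
  -- two arithmetic facts (cf. `Polymath8a.lcm_prime_mul_left`, `Maynard2016.moebius_prime_mul`,
  -- not imported to keep the closure small)
  have lcm_prime_mul_left : ∀ {a b : ℕ}, p.Coprime b → Nat.lcm (p * a) b = p * Nat.lcm a b :=
    fun {a b} hpb => by
      rw [Nat.lcm, Nat.lcm, Nat.Coprime.gcd_mul_left_cancel a hpb, mul_assoc,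
        Nat.mul_div_assoc p ((Nat.gcd_dvd_left a b).mul_right b)]
  have moebius_prime_mul : ∀ {m : ℕ}, ¬ p ∣ m → μ (p * m) = -μ m := fun {m} hpm => by
    rw [ArithmeticFunction.isMultiplicative_moebius.map_mul_of_coprime
        ((Nat.Prime.coprime_iff_not_dvd hp).2 hpm), ArithmeticFunction.moebius_apply_prime hp]
    ring
  -- the toggle
  set tog : (Fin k → ℕ) → (Fin k → ℕ) := fun d =>
    Function.update d j (if p ∣ d j then d j / p else d j * p) with htog
  -- basic facts about `d ∣ r`
  have hdi : ∀ d : Fin k → ℕ, (∀ i, d i ∣ r i) → ∀ i, i ≠ j → ¬ p ∣ d i := by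
    intro d hd i hij h
    have hg := Nat.dvd_gcd (h.trans (hd i)) hpj
    rw [(coprime_apply_of_mem_dkBox hr hij).gcd_eq_one] at hg
    exact hp.one_lt.ne' (Nat.dvd_one.1 hg)
  have hdsq : ∀ d : Fin k → ℕ, (∀ i, d i ∣ r i) → Squarefree (d j) := fun d hd =>
    hrsq.squarefree_of_dvd (hd j)
  have hdivndvd : ∀ d : Fin k → ℕ, (∀ i, d i ∣ r i) → p ∣ d j → ¬ p ∣ d j / p := by
    intro d hd hpd h
    rw [Nat.dvd_div_iff_mul_dvd hpd] at h
    exact hp.not_isUnit (hdsq d hd p h)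
  -- tog d ∣ r
  have htog_dvd : ∀ d : Fin k → ℕ, (∀ i, d i ∣ r i) → ∀ i, tog d i ∣ r i := by
    intro d hd i
    by_cases hi : i = j
    · subst hi
      simp only [htog, Function.update_self]
      split_ifs with hpd
      · exact (Nat.div_dvd_of_dvd hpd).trans (hd i)
      · exact Nat.Coprime.mul_dvd_of_dvd_of_dvd
          (Nat.coprime_comm.1 ((Nat.Prime.coprime_iff_not_dvd hp).2 hpd)) (hd i) hpj
    · simp only [htog, Function.update_of_ne hi]; exact hd i
  refine Finset.sum_involution (fun d _ => tog d) ?_ ?_ ?_ ?_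
  · -- cancellation
    intro d hd
    obtain ⟨-, hdr⟩ := Finset.mem_filter.1 hd
    have hdi' := hdi d hdr
    -- the three invariants, per case
    have key : ((∀ i l, i ≠ l → (tog d i * e i).Coprime (tog d l * e l)) ↔
          ∀ i l, i ≠ l → (d i * e i).Coprime (d l * e l)) ∧
        ((μ (∏ i, tog d i) : ℤ) : ℝ) = -((μ (∏ i, d i) : ℤ) : ℝ) ∧
        (∏ i, (tog d i : ℝ)) / ∏ i, ((Nat.lcm (tog d i) (e i) : ℕ) : ℝ) =
          (∏ i, (d i : ℝ)) / ∏ i, ((Nat.lcm (d i) (e i) : ℕ) : ℝ) := by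
      have hP0 : ∏ i, d i = d j * ∏ i ∈ Finset.univ \ {j}, d i := by
        conv_lhs => rw [← Function.update_eq_self j d]
        exact Finset.prod_update_of_mem (Finset.mem_univ j) d (d j)
      have hP1 : ∏ i, tog d i = (if p ∣ d j then d j / p else d j * p) * ∏ i ∈ Finset.univ \ {j}, d i := by
        simp only [htog]; exact Finset.prod_update_of_mem (Finset.mem_univ j) d _
      have hQ0 : ∏ i, Nat.lcm (d i) (e i) = Nat.lcm (d j) (e j) * ∏ i ∈ Finset.univ \ {j}, Nat.lcm (d i) (e i) := by
        conv_lhs => rw [← Function.update_eq_self j (fun i => Nat.lcm (d i) (e i))]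
        exact Finset.prod_update_of_mem (Finset.mem_univ j) (fun i => Nat.lcm (d i) (e i)) _
      have hQ1 : ∏ i, Nat.lcm (tog d i) (e i) =
          Nat.lcm (if p ∣ d j then d j / p else d j * p) (e j) * ∏ i ∈ Finset.univ \ {j}, Nat.lcm (d i) (e i) := by
        have : (fun i => Nat.lcm (tog d i) (e i)) =
            Function.update (fun i => Nat.lcm (d i) (e i)) j
              (Nat.lcm (if p ∣ d j then d j / p else d j * p) (e j)) := by
          funext i
          by_cases hi : i = j
          · subst hi; simp only [htog, Function.update_self]
          · simp only [htog, Function.update_of_ne hi]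
        rw [this]; exact Finset.prod_update_of_mem (Finset.mem_univ j) _ _
      have hrest : ¬ p ∣ ∏ i ∈ Finset.univ \ {j}, d i := by
        rw [hpprime.dvd_finsetProd_iff]
        rintro ⟨i, hi, hpi⟩
        exact hdi' i (by simpa using hi) hpi
      have hpej : p.Coprime (e j) := (Nat.Prime.coprime_iff_not_dvd hp).2 (hpe j)
      -- cross invariance
      have hcross : (∀ i l, i ≠ l → (tog d i * e i).Coprime (tog d l * e l)) ↔
          ∀ i l, i ≠ l → (d i * e i).Coprime (d l * e l) := by
        simp only [htog]
        refine cross_update_iff d e j _ fun n hn => ?_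
        obtain ⟨l, hl, rfl⟩ := hn
        have hpn : ¬ p ∣ d l * e l := by
          rw [hp.dvd_mul, not_or]; exact ⟨hdi' l hl, hpe l⟩
        split_ifs with hpd
        · conv_rhs => rw [← Nat.div_mul_cancel hpd, show d j / p * p * e j = p * (d j / p * e j) by ring]
          rw [coprime_prime_mul_iff hp hpn]
        · rw [show d j * p * e j = p * (d j * e j) by ring, coprime_prime_mul_iff hp hpn]
      refine ⟨hcross, ?_, ?_⟩
      · -- μ flips
        rw [hP1, hP0]
        split_ifs with hpd
        · have h1 : d j * ∏ i ∈ Finset.univ \ {j}, d i = p * (d j / p * ∏ i ∈ Finset.univ \ {j}, d i) := by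
            conv_lhs => rw [← Nat.div_mul_cancel hpd]
            ring
          have hnd : ¬ p ∣ d j / p * ∏ i ∈ Finset.univ \ {j}, d i := by
            rw [hp.dvd_mul, not_or]; exact ⟨hdivndvd d hdr hpd, hrest⟩
          rw [h1, moebius_prime_mul hnd]; push_cast; ring
        · have h1 : d j * p * ∏ i ∈ Finset.univ \ {j}, d i = p * (d j * ∏ i ∈ Finset.univ \ {j}, d i) := by ring
          have hnd : ¬ p ∣ d j * ∏ i ∈ Finset.univ \ {j}, d i := by
            rw [hp.dvd_mul, not_or]; exact ⟨hpd, hrest⟩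
          rw [h1, moebius_prime_mul hnd]; push_cast; ring
      · -- ∏ tog d / ∏ lcm(tog d, e) = ∏ d / ∏ lcm(d, e): cross-multiplied in ℕ
        have hN : (∏ i, tog d i) * ∏ i, Nat.lcm (d i) (e i) = (∏ i, d i) * ∏ i, Nat.lcm (tog d i) (e i) := by
          rw [hP1, hP0, hQ0, hQ1]
          split_ifs with hpd
          · set v := d j / p with hv
            have hdj : d j = p * v := by rw [hv, mul_comm, Nat.div_mul_cancel hpd]
            rw [hdj, lcm_prime_mul_left hpej]
            ring
          · rw [show d j * p = p * d j by ring, lcm_prime_mul_left hpej]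
            ring
        have hΛ0 : (0 : ℝ) < ∏ i, ((Nat.lcm (d i) (e i) : ℕ) : ℝ) := by
          refine Finset.prod_pos fun i _ => ?_
          have h1 := one_le_of_mem_dkBox (mem_dkBox_of_dvd hr hdr) i
          have h2 : e i ≠ 0 := fun h0 => hpe i (by rw [h0]; exact dvd_zero p)
          exact_mod_cast Nat.lcm_pos h1 (Nat.pos_of_ne_zero h2)
        have hΛ1 : (0 : ℝ) < ∏ i, ((Nat.lcm (tog d i) (e i) : ℕ) : ℝ) := by
          refine Finset.prod_pos fun i _ => ?_
          have h1 := one_le_of_mem_dkBox (mem_dkBox_of_dvd hr (htog_dvd d hdr)) i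
          have h2 : e i ≠ 0 := fun h0 => hpe i (by rw [h0]; exact dvd_zero p)
          exact_mod_cast Nat.lcm_pos h1 (Nat.pos_of_ne_zero h2)
        rw [div_eq_div_iff hΛ1.ne' hΛ0.ne']
        have := congrArg (fun n : ℕ => (n : ℝ)) hN
        push_cast at this
        exact this
    obtain ⟨hc, hμ, hfrac⟩ := key
    by_cases hcr : ∀ i l, i ≠ l → (d i * e i).Coprime (d l * e l)
    · rw [if_pos hcr, if_pos (hc.2 hcr)]
      rw [show ((μ (∏ i, tog d i) : ℤ) : ℝ) * ((μ (∏ i, e i) : ℤ) : ℝ) *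
              ((∏ i, (tog d i : ℝ)) * ∏ i, (e i : ℝ)) / ∏ i, ((Nat.lcm (tog d i) (e i) : ℕ) : ℝ) =
            ((μ (∏ i, tog d i) : ℤ) : ℝ) * ((μ (∏ i, e i) : ℤ) : ℝ) * (∏ i, (e i : ℝ)) *
              ((∏ i, (tog d i : ℝ)) / ∏ i, ((Nat.lcm (tog d i) (e i) : ℕ) : ℝ)) by ring,
        hfrac, hμ]
      ring
    · rw [if_neg hcr, if_neg (fun h => hcr (hc.1 h)), add_zero]
  · -- tog d ≠ d
    intro d hd _ h
    obtain ⟨-, hdr⟩ := Finset.mem_filter.1 hd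
    have hj := congr_fun h j
    simp only [htog, Function.update_self] at hj
    have hd1 : 1 ≤ d j := one_le_of_mem_dkBox (mem_dkBox_of_dvd hr hdr) j
    split_ifs at hj with hpd
    · exact (Nat.div_lt_self hd1 hp.one_lt).ne hj
    · have : d j * p = d j * 1 := by rw [hj, mul_one]
      exact hp.one_lt.ne' (Nat.eq_of_mul_eq_mul_left hd1 this)
  · -- membership
    intro d hd
    obtain ⟨-, hdr⟩ := Finset.mem_filter.1 hd
    exact Finset.mem_filter.2 ⟨mem_dkBox_of_dvd hr (htog_dvd d hdr), htog_dvd d hdr⟩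
  · -- involutive
    intro d hd
    obtain ⟨-, hdr⟩ := Finset.mem_filter.1 hd
    funext i
    by_cases hi : i = j
    · subst hi
      simp only [htog, Function.update_self]
      split_ifs with hpd h2 h3
      · exact absurd h2 (hdivndvd d hdr hpd)
      · exact Nat.div_mul_cancel hpd
      · exact Nat.mul_div_cancel _ hp.pos
      · exact absurd (Dvd.intro_left _ rfl) h3
    · simp only [htog, Function.update_of_ne hi]

/-! ### `T(r,s) = 0` unless `∏ rᵢ = ∏ sᵢ` -/

/-- `T(r,s) = T(s,r)`. [cite: Maynard2016DenseClusters, (9.2) p. 19] -/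
theorem localPairSum_comm (L : Fin k → ℤ × ℤ) (B : ℕ) (R : ℝ) (r s : Fin k → ℕ) :
    localPairSum L B R r s = localPairSum L B R s r := by
  classical
  unfold localPairSum
  rw [Finset.sum_comm]
  refine Finset.sum_congr rfl fun e _ => Finset.sum_congr rfl fun d _ => ?_
  have hiff : (∀ i j, i ≠ j → (d i * e i).Coprime (d j * e j)) ↔
      ∀ i j, i ≠ j → (e i * d i).Coprime (e j * d j) := by
    simp only [mul_comm]
  by_cases h : ∀ i j, i ≠ j → (d i * e i).Coprime (d j * e j)
  · rw [if_pos h, if_pos (hiff.1 h)]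
    simp only [Nat.lcm_comm (d _) (e _)]
    ring
  · rw [if_neg h, if_neg (fun h' => h (hiff.2 h'))]

/-- **`T(r,s) = 0` if a prime divides `∏rᵢ` but not `∏sᵢ`** (`r, s ∈ 𝒟_k(𝓛)`).
[cite: Maynard2016DenseClusters, proof of Prop. 9.1 p. 19 (after (9.5))] -/
theorem localPairSum_eq_zero_of_dvd_of_not_dvd {L : Fin k → ℤ × ℤ} {B : ℕ} {R : ℝ}
    {r s : Fin k → ℕ} (hr : r ∈ dkBox L B R) {p : ℕ} (hp : p.Prime)
    (hpr : p ∣ ∏ i, r i) (hps : ¬ p ∣ ∏ i, s i) : localPairSum L B R r s = 0 := by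
  classical
  obtain ⟨j, -, hpj⟩ := ((Nat.prime_iff.1 hp).dvd_finsetProd_iff _).1 hpr
  unfold localPairSum
  rw [Finset.sum_comm]
  refine Finset.sum_eq_zero fun e he => ?_
  exact sum_filter_dvd_pairTerm_eq_zero hr (Finset.mem_filter.1 he).2 hp hpj hps

/-- `T(r,s) = 0` if a prime divides `∏sᵢ` but not `∏rᵢ`. [cite: Maynard2016DenseClusters, proof of Prop. 9.1 p. 19 (after (9.5))] -/
theorem localPairSum_eq_zero_of_not_dvd_of_dvd {L : Fin k → ℤ × ℤ} {B : ℕ} {R : ℝ}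
    {r s : Fin k → ℕ} (hs : s ∈ dkBox L B R) {p : ℕ} (hp : p.Prime)
    (hpr : ¬ p ∣ ∏ i, r i) (hps : p ∣ ∏ i, s i) : localPairSum L B R r s = 0 := by
  rw [localPairSum_comm]
  exact localPairSum_eq_zero_of_dvd_of_not_dvd hs hp hps hpr

/-- **«We can restrict to `r = s`»**: `T(r,s) = 0` unless `∏rᵢ = ∏sᵢ` (`r, s ∈ 𝒟_k(𝓛)`, whose
products are squarefree). [cite: Maynard2016DenseClusters, proof of Prop. 9.1 p. 19 (after (9.5))] -/
theorem localPairSum_eq_zero_of_prod_ne {L : Fin k → ℤ × ℤ} {B : ℕ} {R : ℝ} {r s : Fin k → ℕ}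
    (hr : r ∈ dkBox L B R) (hs : s ∈ dkBox L B R) (hne : (∏ i, r i) ≠ ∏ i, s i) :
    localPairSum L B R r s = 0 := by
  have h := (Nat.Squarefree.ext_iff (squarefree_of_mem_dkBox hr) (squarefree_of_mem_dkBox hs)).not.1 hne
  obtain ⟨p, hp'⟩ := not_forall.1 h
  obtain ⟨hp, hiff⟩ := Classical.not_imp.1 hp'
  by_cases hpr : p ∣ ∏ i, r i
  · exact localPairSum_eq_zero_of_dvd_of_not_dvd hr hp hpr
      (fun hps => hiff ⟨fun _ => hps, fun _ => hpr⟩)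
  · refine localPairSum_eq_zero_of_not_dvd_of_dvd hs hp hpr ?_
    by_contra hps
    exact hiff ⟨fun h => absurd h hpr, fun h => absurd h hps⟩

end Literature.NumberTheory.Sieve.FGKMT2018
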